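import Literature.NumberTheory.EllipticCurves.DivisionFieldRamificationProofs
import Literature.NumberTheory.EllipticCurves.KummerInertiaSurjectiveProofs
import Mathlib.GroupTheory.GroupAction.FixedPoints
import HarnessLib

/-!
# The inertia group of a prime `𝔓 ∣ v` of `\bar ℤ_K` fixes the roots of unity of order prime to `v`;
# adjoining such roots (e.g. `√−1` away from `2`) does not ramify

`Proofs` file (theorems only), topic `NumberTheory/GaloisRepresentations`; GLOBAL (number-field)
companion of the local `mem_absInertia_iff_smul_rootsOfUnity` (`InertiaRootsOfUnity.lean`: for a local
field, `I_F` is the fixator of the prime-to-`p` roots of unity — Serre, *Local Fields* IV §4, Cor. 2 to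
Prop. 16; Serre, Invent. Math. 15 (1972) §1.2–1.3).  For a number field `K`, a finite place `v`, a prime
`𝔓` of `\bar ℤ_K = absIntegers (𝓞 K) K` over `v` and `σ ∈ I_𝔓 ≤ Γ_K`:

* `Literature.NumberTheory.GaloisRepresentations.smul_eq_of_mem_inertia_of_pow_eq_one` — **`σ • ζ = ζ`
  for every `ζ ∈ K̄` with `ζ^m = 1`, `m ∉ v`** (roots of unity of order prime to the residue
  characteristic are distinct modulo `𝔓`: the tree's `eq_of_pow_eq_one_of_sub_mem`);
* `…inertia_le_fixingSubgroup_adjoin_of_forall_smul_eq` — if `I_𝔓` fixes every element of `S ⊆ K̄` then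
  `I_𝔓 ≤ Gal(K̄/K(S))`;
* `…ramificationIdx_adjoin_eq_one_of_forall_smul_eq` — hence, for `K(S)/K` finite Galois, `e(Q ∣ v) = 1`
  at every prime `Q` of `𝓞 K(S)` over `v` (with `ramificationIdx_eq_one_of_inertia_le_fixingSubgroup` of
  `DivisionFieldRamificationProofs`), and the instance for roots of unity
  `…ramificationIdx_adjoin_rootsOfUnity_eq_one` (`S` = roots of unity of orders prime to `v`).

Consumer (cell abc-iut): the field `F = F_tpd(√−1, E_{F_tpd}[3·5])` of [IUTchIV] Thm. 1.10 / Cor. 2.2 —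
the `√−1 = ζ₄` part is unramified away from `2` — combined with the division-field part
(`WeierstrassCurve.ramificationIdx_divisionField_eq_one_of_hasGoodReductionAt`) through
`inertia_le_fixingSubgroup_adjoin_of_forall_smul_eq`.  Classical; nothing here bears on
[IUTchIII] Cor. 3.12.

## References

* [SerreLocalFields1979] J.-P. Serre, *Local Fields*, Ch. IV §4, Cor. 2 to Prop. 16.
* [Serre1972] J.-P. Serre, Invent. Math. 15 (1972), §1.3.
* [NeukirchANT1999] J. Neukirch, *Algebraic Number Theory*, Ch. I §9 Prop. (9.6), Ch. II (7.12)–(7.13)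
  (adjoining prime-to-`p` roots of unity is unramified).
-/

noncomputable section

open scoped Pointwise IntermediateField NumberField

open NumberField IsDedekindDomain IntermediateField Field

universe u

namespace Literature.NumberTheory.GaloisRepresentations

variable {K : Type u} [Field K] [NumberField K]

/-- **The inertia group `I_𝔓 ≤ Γ_K` of a prime `𝔓 ∣ v` of `\bar ℤ_K` fixes every root of unity of order
`m ∉ v`** (`ζ ∈ K̄`, `ζ^m = 1`): `ζ` is integral, `σ • ζ ≡ ζ (mod 𝔓)` by definition of inertia, and
`m`-th roots of unity are distinct modulo a prime not containing `m`. (Serre, *Local Fields* IV §4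
Cor. 2; Neukirch II (7.13): `K(μ_m)/K` is unramified at `v ∤ m`.)
[cite: SerreLocalFields1979, Ch. IV §4, Cor. 2 to Prop. 16] [cite: NeukirchANT1999, Ch. II Prop. (7.13)] -/
theorem smul_eq_of_mem_inertia_of_pow_eq_one (v : HeightOneSpectrum (𝓞 K))
    {𝔓 : Ideal (absIntegers (𝓞 K) K)} (h𝔓 : 𝔓 ∈ v.primesAbove)
    {σ : absoluteGaloisGroup K} (hσ : σ ∈ 𝔓.inertia (absoluteGaloisGroup K))
    {m : ℕ} (hm : (m : 𝓞 K) ∉ v.asIdeal) {ζ : AlgebraicClosure K} (hζ : ζ ^ m = 1) :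
    σ • ζ = ζ := by
  haveI : 𝔓.IsPrime := h𝔓.1
  haveI : 𝔓.LiesOver v.asIdeal := h𝔓.2
  rcases Nat.eq_zero_or_pos m with rfl | hm0
  · exact absurd (by simp) hm
  -- `ζ` is integral over `𝓞 K`
  have hζint : ζ ∈ absIntegers (𝓞 K) K := by
    rw [absIntegers, mem_integralClosure_iff]
    exact (IsIntegral.of_pow hm0 (by rw [hζ]; exact isIntegral_one) : IsIntegral ℤ ζ).tower_top
  set z : absIntegers (𝓞 K) K := ⟨ζ, hζint⟩ with hzdef
  -- `σ • z - z ∈ 𝔓` (inertia) and both are `m`-th roots of unity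
  rw [Ideal.inertia, AddSubgroup.mem_inertia] at hσ
  have h1 : σ • z - z ∈ 𝔓 := hσ z
  have hz : z ^ m = 1 := Subtype.ext (by
    change ζ ^ m = 1
    exact hζ)
  have hσz : (σ • z) ^ m = 1 := by rw [← smul_pow', hz, smul_one]
  -- `m ∉ 𝔓`
  have hmP : ((m : ℕ) : absIntegers (𝓞 K) K) ∉ 𝔓 := by
    intro h
    apply hm
    have h' : algebraMap (𝓞 K) (absIntegers (𝓞 K) K) (m : 𝓞 K) ∈ 𝔓 := by rwa [map_natCast]
    rw [← Ideal.mem_comap] at h'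
    rw [show v.asIdeal = 𝔓.comap (algebraMap (𝓞 K) (absIntegers (𝓞 K) K)) from Ideal.LiesOver.over]
    exact h'
  have key := Literature.NumberTheory.EllipticCurves.eq_of_pow_eq_one_of_sub_mem (P := 𝔓) hmP hσz hz h1
  have := congrArg (fun t : absIntegers (𝓞 K) K ↦ (t : AlgebraicClosure K)) key
  simpa [hzdef, integralClosure.coe_smul] using this

omit [NumberField K] in
/-- **If the inertia group `I_𝔓` fixes every element of `S ⊆ K̄`, it fixes `K(S)` pointwise**:
`I_𝔓 ≤ Gal(K̄/K(S))` (`K(S) = IntermediateField.adjoin K S`; `adjoin K S ≤ fixedField`).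
[cite: NeukirchANT1999, Ch. I §9 Prop. (9.6)] -/
theorem inertia_le_fixingSubgroup_adjoin_of_forall_smul_eq
    (𝔓 : Ideal (absIntegers (𝓞 K) K)) (S : Set (AlgebraicClosure K))
    (hS : ∀ σ ∈ 𝔓.inertia (absoluteGaloisGroup K), ∀ s ∈ S, σ • s = s) :
    𝔓.inertia (AlgebraicClosure K ≃ₐ[K] AlgebraicClosure K) ≤
      (IntermediateField.adjoin K S).fixingSubgroup := by
  intro σ hσ
  rw [IntermediateField.mem_fixingSubgroup_iff]
  have hle : IntermediateField.adjoin K S ≤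
      IntermediateField.fixedField (Subgroup.zpowers σ) := by
    rw [IntermediateField.adjoin_le_iff]
    intro s hs
    rw [SetLike.mem_coe, IntermediateField.mem_fixedField_iff]
    rintro τ ⟨k, rfl⟩
    have h1 : σ • s = s := hS σ hσ s hs
    exact MulAction.fixedBy_subset_fixedBy_zpow (AlgebraicClosure K) σ k h1
  intro x hx
  exact (IntermediateField.mem_fixedField_iff _ _).mp (hle hx) σ (Subgroup.mem_zpowers σ)

/-- **`K(S)/K` is unramified over `v` when `I_𝔓` fixes `S` pointwise for some `𝔓 ∣ v`**: for `K(S)`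
finite Galois over `K`, `e(Q ∣ v) = 1` for every prime `Q` of `𝓞 K(S)` over `v`.
[cite: NeukirchANT1999, Ch. I §9 Prop. (9.6)] -/
theorem ramificationIdx_adjoin_eq_one_of_forall_smul_eq (v : HeightOneSpectrum (𝓞 K))
    (S : Set (AlgebraicClosure K)) [FiniteDimensional K (IntermediateField.adjoin K S)]
    [IsGalois K (IntermediateField.adjoin K S)]
    {𝔓 : Ideal (absIntegers (𝓞 K) K)} (h𝔓 : 𝔓 ∈ v.primesAbove)
    (hS : ∀ σ ∈ 𝔓.inertia (absoluteGaloisGroup K), ∀ s ∈ S, σ • s = s)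
    (Q : Ideal (𝓞 (IntermediateField.adjoin K S))) [Q.IsPrime] [Q.LiesOver v.asIdeal] :
    Q.ramificationIdx (𝓞 K) = 1 :=
  @Literature.NumberTheory.EllipticCurves.ramificationIdx_eq_one_of_inertia_le_fixingSubgroup K _ _
    (IntermediateField.adjoin K S) _ _ v 𝔓 h𝔓.1 h𝔓.2
    (inertia_le_fixingSubgroup_adjoin_of_forall_smul_eq 𝔓 S hS) Q _ _

/-- **Adjoining roots of unity of order prime to `v` does not ramify over `v`**: if every `s ∈ S` satisfies
`s ^ m_s = 1` with `m_s ∉ v`, and `K(S)/K` is finite Galois, then `e(Q ∣ v) = 1` for every prime `Q` of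
`𝓞 K(S)` over `v` (e.g. `S = {√−1}`, `m = 4`, `v ∤ 2` — the `√−1` of the field `F = F_tpd(√−1, E[3·5])`
of [IUTchIV] Thm. 1.10). [cite: NeukirchANT1999, Ch. II Prop. (7.13)] [cite: SerreLocalFields1979, Ch. IV §4, Cor. 2 to Prop. 16] -/
theorem ramificationIdx_adjoin_rootsOfUnity_eq_one (v : HeightOneSpectrum (𝓞 K))
    (S : Set (AlgebraicClosure K)) (hroots : ∀ s ∈ S, ∃ m : ℕ, (m : 𝓞 K) ∉ v.asIdeal ∧ s ^ m = 1)
    [FiniteDimensional K (IntermediateField.adjoin K S)] [IsGalois K (IntermediateField.adjoin K S)]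
    (Q : Ideal (𝓞 (IntermediateField.adjoin K S))) [Q.IsPrime] [Q.LiesOver v.asIdeal] :
    Q.ramificationIdx (𝓞 K) = 1 := by
  obtain ⟨𝔓, h𝔓⟩ := HeightOneSpectrum.primesAbove_nonempty v
  refine ramificationIdx_adjoin_eq_one_of_forall_smul_eq v S h𝔓 (fun σ hσ s hs ↦ ?_) Q
  obtain ⟨m, hm, hsm⟩ := hroots s hs
  exact smul_eq_of_mem_inertia_of_pow_eq_one v h𝔓 hσ hm hsm

end Literature.NumberTheory.GaloisRepresentations

end
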